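import Summits.ValiantsHypothesis.ValiantsHypothesis.Theorems.KPlusLogSqLawTropicalBLexShiftStructure

/-!
# Route «KPlusLogSqLaw», crux `TropicalB` (stmt-ValiantsHypothesis-19771) — LEX-NT, part 9b: pairwise-law structure of the shifted core `T_1`
# when the top column of `A` IS a top column of `B` or `C` (but its cell is not shared)

HONEST FRAMING.  Structure lemmas (pairwise exchange law only) for dominance designs of any format, sequel of `…TropicalBLexShiftStructure`
(seat val-sym-trop-p5 g14, 2026-08-28; cell `pub-symmetroid`, `--supports stmt-ValiantsHypothesis-19771 --as helper`): the same conclusions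
(`α⁻¹β` one cycle through both top columns of `B`; the cycle of `p` under `α⁻¹γ` contains both top columns of `C`, the rest is in it or is the twin)
under the weaker hypothesis that `A`'s top CELL is not a cell of `B` (resp. `C`) — `p` itself may be a top column of `B` (resp. `C`).  They feed the
second lex core law beyond the generic case (`…TropicalBLexShiftOne`).  Nothing here bears on `TropicalB` in its window, `WeakLifting`, DoorA26 /
DoorA34, `MatrixDescartes` (stmt-ValiantsHypothesis-18050) or VP ≠ VNP.  [this cell; the exchange law is the tree's]
-/

set_option linter.dupNamespace false
set_option autoImplicit false

namespace Summit.ValiantsHypothesis.ValiantsHypothesis.Theorems.KPlusLogSqLaw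

namespace LexCore

open Summit.ValiantsHypothesis.ValiantsHypothesis.Theorems.MatrixDescartes.Negative
open Finset

variable {m K : ℕ}

/-- a sum of a function supported on three named columns. [folklore] -/
theorem sum_three_supported (T : Finset (Fin m)) (a b c : Fin m) (X Y Z : ℤ) :
    ∑ t ∈ T, ((if t = a then X else 0) + (if t = b then Y else 0) + (if t = c then Z else 0)) =
      (if a ∈ T then X else 0) + (if b ∈ T then Y else 0) + (if c ∈ T then Z else 0) := by
  rw [Finset.sum_add_distrib, Finset.sum_add_distrib, Finset.sum_ite_eq' T a, Finset.sum_ite_eq' T b, Finset.sum_ite_eq' T c]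

/-- **`π = α⁻¹β` is one cycle** as soon as `A`'s top cell is not a cell of `B` (`β p ≠ α p`); `p` may be one of `q₁, q₂`. [this cell] -/
theorem shift_pi_structure' (d : Fin K → ℕ) (v ε : Fin m → Fin m → Fin K → ℤ) {θA θB : ℤ} (hAB : θA < θB)
    {α β : Equiv.Perm (Fin m)} {lA lB : Fin m → Fin K} (hA : IsDominant d v ε θA (α, lA)) (hB : IsDominant d v ε θB (β, lB))
    (c₁ c₂ c₃ : Fin K) (h12 : d c₁ < d c₂) (h23 : d c₂ < d c₃) (p q₁ q₂ : Fin m) (hq : q₁ ≠ q₂) (hnp : β p ≠ α p)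
    (hlAp : lA p = c₃) (hlA : ∀ b, b ≠ p → lA b = c₂) (hlB1 : lB q₁ = c₃) (hlB2 : lB q₂ = c₃)
    (hlB : ∀ b, b ≠ q₁ → b ≠ q₂ → lB b = c₁) :
    (∀ b, (α⁻¹ * β) b ≠ b) ∧ (∀ b, (α⁻¹ * β).SameCycle p b) := by
  classical
  set π := α⁻¹ * β with hπ
  have hπp : π p ≠ p := by
    intro h; apply hnp
    have : α (π p) = α p := by rw [h]
    simpa [hπ, Equiv.Perm.mul_apply] using this
  set X : ℤ := (d c₃ : ℤ) - d c₂ with hX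
  set Z : ℤ := (d (lB p) : ℤ) - d c₃ - (if p = q₁ then X else 0) - (if p = q₂ then X else 0) with hZ
  -- pointwise majorant supported on `{q₁, q₂, p}`, exact at `p`
  have hpt : ∀ b, (d (lB b) : ℤ) - d (lA b) ≤ (if b = q₁ then X else 0) + (if b = q₂ then X else 0) + (if b = p then Z else 0) := by
    intro b
    by_cases hbp : b = p
    · subst hbp; rw [hlAp, if_pos rfl, hZ]; linarith
    · rw [hlA b hbp, if_neg hbp, add_zero]
      by_cases h1 : b = q₁
      · subst h1; rw [hlB1, if_pos rfl]; split_ifs <;> linarith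
      · rw [if_neg h1]
        by_cases h2 : b = q₂
        · subst h2; rw [hlB2, if_pos rfl]; linarith
        · rw [if_neg h2, hlB b h1 h2]; have := h12; push_cast; omega
  have law : ∀ T : Finset (Fin m), (∀ b, π b ∈ T ↔ b ∈ T) → (∃ b ∈ T, α b ≠ β b ∨ lA b ≠ lB b) →
      (0 : ℤ) < ∑ b ∈ T, ((d (lB b) : ℤ) - d (lA b)) := by
    intro T hT hne
    have h := sum_d_lt_of_isDominant_invariant d v ε hAB hA hB T hT hne
    rw [Finset.sum_sub_distrib]; linarith
  have bound : ∀ T : Finset (Fin m), ∑ b ∈ T, ((d (lB b) : ℤ) - d (lA b)) ≤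
      (if q₁ ∈ T then X else 0) + (if q₂ ∈ T then X else 0) + (if p ∈ T then Z else 0) := by
    intro T
    refine le_trans (Finset.sum_le_sum fun b _ => hpt b) ?_
    rw [sum_three_supported]
  have hdiff : ∀ b, b ≠ p → lA b ≠ lB b := by
    intro b hbp h
    rw [hlA b hbp] at h
    by_cases hb1 : b = q₁
    · rw [hb1, hlB1] at h; exact (ne_of_lt h23) (by rw [h])
    · by_cases hb2 : b = q₂
      · rw [hb2, hlB2] at h; exact (ne_of_lt h23) (by rw [h])
      · rw [hlB b hb1 hb2] at h; exact (ne_of_lt h12) (by rw [← h])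
  have hX0 : 0 < X := by rw [hX]; have := h23; omega
  have h13 : (d c₁ : ℤ) < d c₃ := by exact_mod_cast h12.trans h23
  -- the value of `Z`
  have hZval : (p ≠ q₁ ∧ p ≠ q₂ → Z = (d c₁ : ℤ) - d c₃) ∧ (p = q₁ → Z = -X) ∧ (p = q₂ → Z = -X) := by
    refine ⟨fun h => ?_, fun h => ?_, fun h => ?_⟩
    · rw [hZ, if_neg h.1, if_neg h.2, hlB p h.1 h.2]; ring
    · rw [hZ, if_pos h, if_neg (fun e => hq (h.symm.trans e)), h, hlB1]; ring
    · rw [hZ, if_neg (fun e => hq (e.symm.trans h)), if_pos h, h, hlB2]; ring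
  -- (a) the cycle of `p` contains `q₁` and `q₂`
  set T₀ := univ.filter fun z => π.SameCycle p z with hT₀
  have hpT₀ : p ∈ T₀ := by
    simp only [hT₀, Finset.mem_filter, Finset.mem_univ, true_and]; exact Equiv.Perm.SameCycle.refl _ _
  have hchg : ∃ b ∈ T₀, α b ≠ β b ∨ lA b ≠ lB b := by
    refine ⟨p, hpT₀, Or.inl fun h => hπp ?_⟩
    rw [hπ, Equiv.Perm.mul_apply, Equiv.Perm.inv_eq_iff_eq]; exact h.symm
  have hq₁₂ : q₁ ∈ T₀ ∧ q₂ ∈ T₀ := by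
    have hl := law T₀ (cycle_invariant π p) hchg
    have hb := bound T₀
    rw [if_pos hpT₀] at hb
    by_cases hp1 : p = q₁
    · have hZ' := hZval.2.1 hp1
      refine ⟨hp1 ▸ hpT₀, ?_⟩
      by_contra h2
      rw [if_pos (hp1 ▸ hpT₀), if_neg h2, hZ'] at hb; linarith
    · by_cases hp2 : p = q₂
      · have hZ' := hZval.2.2 hp2
        refine ⟨?_, hp2 ▸ hpT₀⟩
        by_contra h1
        rw [if_neg h1, if_pos (hp2 ▸ hpT₀), hZ'] at hb; linarith
      · have hZ' := hZval.1 ⟨hp1, hp2⟩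
        rw [hZ'] at hb
        by_contra hnot
        rw [not_and_or] at hnot
        rcases hnot with h | h
        · rw [if_neg h] at hb; split_ifs at hb <;> linarith
        · rw [if_neg h] at hb; split_ifs at hb <;> linarith
  have hpq₁ : π.SameCycle p q₁ := by simpa [hT₀] using hq₁₂.1
  have hpq₂ : π.SameCycle p q₂ := by simpa [hT₀] using hq₁₂.2
  -- (b) every column is in the cycle of `p`
  have hall : ∀ b, π.SameCycle p b := by
    intro b
    by_contra hb
    have hbp : b ≠ p := fun e => hb (e ▸ Equiv.Perm.SameCycle.refl _ _)
    set T₁ := univ.filter fun z => π.SameCycle b z with hT₁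
    have hbT₁ : b ∈ T₁ := by
      simp only [hT₁, Finset.mem_filter, Finset.mem_univ, true_and]; exact Equiv.Perm.SameCycle.refl _ _
    have hnot : ∀ z ∈ T₁, ¬ π.SameCycle p z := by
      intro z hz hpz
      simp only [hT₁, Finset.mem_filter, Finset.mem_univ, true_and] at hz
      exact hb (hpz.trans hz.symm)
    have hl := law T₁ (cycle_invariant π b) ⟨b, hbT₁, Or.inr (hdiff b hbp)⟩
    have hbd := bound T₁
    rw [if_neg (fun h => hnot q₁ h hpq₁), if_neg (fun h => hnot q₂ h hpq₂),
      if_neg (fun h => hnot p h (Equiv.Perm.SameCycle.refl _ _))] at hbd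
    linarith
  refine ⟨fun b hfix => ?_, hall⟩
  have hpb : p = b := (hall b).eq_of_right hfix
  subst hpb
  exact hπp hfix

/-- **the cycle of `p` under `ρ = α⁻¹γ` contains both top columns of `C`, the rest is in it or is the twin** — as soon as `A`'s top cell is not
a cell of `C` (`γ p ≠ α p`); `p` may be one of `r₁, r₂` (but not `y`'s role: `y ∉ {r₁, r₂}`). [this cell] -/
theorem shift_rho_structure' (d : Fin K → ℕ) (v ε : Fin m → Fin m → Fin K → ℤ) {θA θC : ℤ} (hAC : θA < θC)
    {α γ : Equiv.Perm (Fin m)} {lA lC : Fin m → Fin K} (hA : IsDominant d v ε θA (α, lA)) (hC : IsDominant d v ε θC (γ, lC))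
    (c₀ c₂ c₃ : Fin K) (h02 : d c₀ < d c₂) (h23 : d c₂ < d c₃) (p r₁ r₂ y : Fin m) (hr : r₁ ≠ r₂) (hnp : γ p ≠ α p)
    (hy1 : y ≠ r₁) (hy2 : y ≠ r₂)
    (hlAp : lA p = c₃) (hlA : ∀ b, b ≠ p → lA b = c₂) (hlC1 : lC r₁ = c₃) (hlC2 : lC r₂ = c₃) (hlCy : lC y = c₂)
    (hlC : ∀ b, b ≠ r₁ → b ≠ r₂ → b ≠ y → lC b = c₀) :
    ((α⁻¹ * γ).SameCycle p r₁ ∧ (α⁻¹ * γ).SameCycle p r₂) ∧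
      ∀ b, (α⁻¹ * γ).SameCycle p b ∨ (b = y ∧ γ y = α y ∧ y ≠ p) := by
  classical
  set ρ := α⁻¹ * γ with hρ
  have hρp : ρ p ≠ p := by
    intro h; apply hnp
    have : α (ρ p) = α p := by rw [h]
    simpa [hρ, Equiv.Perm.mul_apply] using this
  set X : ℤ := (d c₃ : ℤ) - d c₂ with hX
  set Z : ℤ := (d (lC p) : ℤ) - d c₃ - (if p = r₁ then X else 0) - (if p = r₂ then X else 0) with hZ
  have hpt : ∀ b, (d (lC b) : ℤ) - d (lA b) ≤ (if b = r₁ then X else 0) + (if b = r₂ then X else 0) + (if b = p then Z else 0) := by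
    intro b
    by_cases hbp : b = p
    · subst hbp; rw [hlAp, if_pos rfl, hZ]; linarith
    · rw [hlA b hbp, if_neg hbp, add_zero]
      by_cases h1 : b = r₁
      · subst h1; rw [hlC1, if_pos rfl]; split_ifs <;> linarith
      · rw [if_neg h1]
        by_cases h2 : b = r₂
        · subst h2; rw [hlC2, if_pos rfl]; linarith
        · rw [if_neg h2]
          by_cases hby : b = y
          · rw [hby, hlCy]; simp
          · rw [hlC b h1 h2 hby]; have := h02; push_cast; omega
  have law : ∀ T : Finset (Fin m), (∀ b, ρ b ∈ T ↔ b ∈ T) → (∃ b ∈ T, α b ≠ γ b ∨ lA b ≠ lC b) →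
      (0 : ℤ) < ∑ b ∈ T, ((d (lC b) : ℤ) - d (lA b)) := by
    intro T hT hne
    have h := sum_d_lt_of_isDominant_invariant d v ε hAC hA hC T hT hne
    rw [Finset.sum_sub_distrib]; linarith
  have bound : ∀ T : Finset (Fin m), ∑ b ∈ T, ((d (lC b) : ℤ) - d (lA b)) ≤
      (if r₁ ∈ T then X else 0) + (if r₂ ∈ T then X else 0) + (if p ∈ T then Z else 0) := by
    intro T
    refine le_trans (Finset.sum_le_sum fun b _ => hpt b) ?_
    rw [sum_three_supported]
  have hdiff : ∀ b, b ≠ p → lA b = lC b → b = y := by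
    intro b hbp h
    rw [hlA b hbp] at h
    by_cases hb1 : b = r₁
    · exfalso; rw [hb1, hlC1] at h; exact (ne_of_lt h23) (by rw [h])
    · by_cases hb2 : b = r₂
      · exfalso; rw [hb2, hlC2] at h; exact (ne_of_lt h23) (by rw [h])
      · by_contra hby
        rw [hlC b hb1 hb2 hby] at h; exact (ne_of_lt h02) (by rw [h])
  have hX0 : 0 < X := by rw [hX]; have := h23; omega
  have hZval : (p ≠ r₁ ∧ p ≠ r₂ → Z ≤ -X) ∧ (p = r₁ → Z = -X) ∧ (p = r₂ → Z = -X) := by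
    refine ⟨fun h => ?_, fun h => ?_, fun h => ?_⟩
    · rw [hZ, if_neg h.1, if_neg h.2]
      by_cases hpy : p = y
      · rw [hpy, hlCy]; simp [hX]
      · rw [hlC p h.1 h.2 hpy]; simp [hX]; have := h02; omega
    · rw [hZ, if_pos h, if_neg (fun e => hr (h.symm.trans e)), h, hlC1]; ring
    · rw [hZ, if_neg (fun e => hr (e.symm.trans h)), if_pos h, h, hlC2]; ring
  set T₀ := univ.filter fun z => ρ.SameCycle p z with hT₀
  have hpT₀ : p ∈ T₀ := by
    simp only [hT₀, Finset.mem_filter, Finset.mem_univ, true_and]; exact Equiv.Perm.SameCycle.refl _ _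
  have hchg : ∃ b ∈ T₀, α b ≠ γ b ∨ lA b ≠ lC b := by
    refine ⟨p, hpT₀, Or.inl fun h => hρp ?_⟩
    rw [hρ, Equiv.Perm.mul_apply, Equiv.Perm.inv_eq_iff_eq]; exact h.symm
  have hr12 : r₁ ∈ T₀ ∧ r₂ ∈ T₀ := by
    have hl := law T₀ (cycle_invariant ρ p) hchg
    have hb := bound T₀
    rw [if_pos hpT₀] at hb
    by_cases hp1 : p = r₁
    · have hZ' := hZval.2.1 hp1
      refine ⟨hp1 ▸ hpT₀, ?_⟩
      by_contra h2
      rw [if_pos (hp1 ▸ hpT₀), if_neg h2, hZ'] at hb; linarith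
    · by_cases hp2 : p = r₂
      · have hZ' := hZval.2.2 hp2
        refine ⟨?_, hp2 ▸ hpT₀⟩
        by_contra h1
        rw [if_neg h1, if_pos (hp2 ▸ hpT₀), hZ'] at hb; linarith
      · have hZ' := hZval.1 ⟨hp1, hp2⟩
        by_contra hnot
        rw [not_and_or] at hnot
        rcases hnot with h | h
        · rw [if_neg h] at hb; split_ifs at hb <;> linarith
        · rw [if_neg h] at hb; split_ifs at hb <;> linarith
  have hmem : ∀ z, z ∈ T₀ ↔ ρ.SameCycle p z := fun z => by simp [hT₀]
  refine ⟨⟨(hmem r₁).mp hr12.1, (hmem r₂).mp hr12.2⟩, fun b => ?_⟩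
  by_cases hb : ρ.SameCycle p b
  · exact Or.inl hb
  · right
    have hbp : b ≠ p := fun e => hb (e ▸ Equiv.Perm.SameCycle.refl _ _)
    set T₁ := univ.filter fun z => ρ.SameCycle b z with hT₁
    have hbT₁ : b ∈ T₁ := by
      simp only [hT₁, Finset.mem_filter, Finset.mem_univ, true_and]; exact Equiv.Perm.SameCycle.refl _ _
    have hnot : ∀ z ∈ T₁, ¬ ρ.SameCycle p z := by
      intro z hz hpz
      simp only [hT₁, Finset.mem_filter, Finset.mem_univ, true_and] at hz
      exact hb (hpz.trans hz.symm)
    have hsame : ∀ z ∈ T₁, α z = γ z ∧ lA z = lC z := by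
      by_contra hne
      push Not at hne
      obtain ⟨z, hz, hzz⟩ := hne
      have hex : ∃ z ∈ T₁, α z ≠ γ z ∨ lA z ≠ lC z := by
        refine ⟨z, hz, ?_⟩
        by_cases h : α z = γ z
        · exact Or.inr (hzz h)
        · exact Or.inl h
      have hl := law T₁ (cycle_invariant ρ b) hex
      have hbd := bound T₁
      rw [if_neg (fun h => hnot r₁ h ((hmem r₁).mp hr12.1)), if_neg (fun h => hnot r₂ h ((hmem r₂).mp hr12.2)),
        if_neg (fun h => hnot p h (Equiv.Perm.SameCycle.refl _ _))] at hbd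
      linarith
    obtain ⟨hcell, hcls⟩ := hsame b hbT₁
    have hby := hdiff b hbp hcls
    subst hby
    exact ⟨rfl, hcell.symm, hbp⟩

end LexCore

end Summit.ValiantsHypothesis.ValiantsHypothesis.Theorems.KPlusLogSqLaw
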